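import Summits.Parity.GeneralizedHardyLittlewood.Theorems.LeeYangFibresRelativeDimOneTypeDefs
import Summits.Parity.GeneralizedHardyLittlewood.Theorems.LeeYangFibresRelativeDimOneSplitEulerExpansion
import Mathlib.NumberTheory.Primorial
import HarnessLib

/-!
# Route `LeeYangFibres`, crux `RelativeDimOne` (stmt-Parity-14113), line `gallagher-backwards-split` (RESHAPED,
# type-conditioned split): singular-weight fact (W4) for the stub `stub_singularWeights`

(W4) THE `w`-SMOOTH PART OF THE TRUNCATED SINGULAR-SERIES SPECTRUM AT LEVEL `N^θ` IS `∏_{p ≤ w} β_p`, with the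
conditioning height `w = ⌊log₄ N⌋ / D`, `D ≥ D₀(θ) = ⌈1/θ⌉`.

Proof. By the Euler expansion (`singularProductPartial_eq_sum_powerset`)
`∏_{p ≤ w} β_p = Σ_{U ⊆ {p ≤ w}} ∏_{p ∈ U} (β_p − 1) = Σ_{q squarefree, w-smooth} ∏_{p ∣ q} (β_p − 1)`, the full sum
of the spectrum `hlCoeff q a b = ∏_{p∣q}(β_p − 1)` over ALL `w`-smooth squarefree moduli (`q ↦ primeFactors q`,
`U ↦ ∏ U`). The smooth band sum `smoothBand ⌊N^θ⌋ w` keeps the moduli `q ≤ ⌊N^θ⌋`; but every `w`-smooth squarefree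
`q` divides `∏_{p ≤ w} p ≤ 4^w` (`primorial_le_four_pow`) and `4^{wD} ≤ 4^{⌊log₄ N⌋} ≤ N`, so
`q ≤ N^{1/D} ≤ N^θ` once `D ≥ 1/θ` (`N ≥ 1`): nothing is cut and the difference is `0 ≤ ε`.
-/

noncomputable section

open scoped BigOperators Classical
open Finset Literature.NumberTheory.Sieve
open Summit.Parity.GeneralizedHardyLittlewood.Cruxes.RelativeDimOne.GallagherBackwardsSplit

namespace Summit.Parity.GeneralizedHardyLittlewood.Cruxes.RelativeDimOne.TypeSplit

variable {t : ℕ}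

namespace SingularWeights

/-- For `D ≥ 1/θ` and `N ≥ 1`: `∏_{p ≤ w} p ≤ 4^w ≤ N^{1/D} ≤ N^θ`, `w = ⌊log₄ N⌋ / D`, so the primorial of the
conditioning height is at most the level `⌊N^θ⌋`. -/
theorem primorial_wlev_le_level {θ : ℝ} (hθ : 0 < θ) {D : ℕ} (hD : 1 / θ ≤ D) {N : ℕ} (hN : 1 ≤ N) :
    primorial (wlev D N) ≤ level θ N := by
  have hDr : (0 : ℝ) < D := lt_of_lt_of_le (by positivity) hD
  have hD0 : 0 < D := by exact_mod_cast hDr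
  have h1 : 4 ^ (wlev D N * D) ≤ N :=
    calc 4 ^ (wlev D N * D) ≤ 4 ^ (Nat.log 4 N) := Nat.pow_le_pow_right (by norm_num) (Nat.div_mul_le_self _ _)
      _ ≤ N := Nat.pow_log_le_self 4 (by omega)
  have h2 : primorial (wlev D N) ≤ 4 ^ wlev D N := primorial_le_four_pow _
  unfold level
  refine Nat.le_floor ?_
  have hNr : (1 : ℝ) ≤ N := by exact_mod_cast hN
  have h3 : ((4 : ℝ) ^ wlev D N) ^ (D : ℝ) ≤ N := by
    rw [Real.rpow_natCast, ← pow_mul]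
    exact_mod_cast h1
  have h4 : (4 : ℝ) ^ wlev D N ≤ (N : ℝ) ^ (1 / (D : ℝ)) :=
    calc (4 : ℝ) ^ wlev D N = (((4 : ℝ) ^ wlev D N) ^ (D : ℝ)) ^ (1 / (D : ℝ)) := by
          rw [← Real.rpow_mul (by positivity), mul_one_div_cancel hDr.ne', Real.rpow_one]
      _ ≤ (N : ℝ) ^ (1 / (D : ℝ)) := Real.rpow_le_rpow (by positivity) h3 (by positivity)
  have h5 : (N : ℝ) ^ (1 / (D : ℝ)) ≤ (N : ℝ) ^ θ := by
    refine Real.rpow_le_rpow_of_exponent_le hNr ?_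
    rw [div_le_iff₀ hDr]
    have := (div_le_iff₀ hθ).mp hD
    linarith
  calc ((primorial (wlev D N) : ℕ) : ℝ) ≤ ((4 ^ wlev D N : ℕ) : ℝ) := by exact_mod_cast h2
    _ = (4 : ℝ) ^ wlev D N := by push_cast; ring
    _ ≤ (N : ℝ) ^ θ := h4.trans h5

/-- When `∏_{p ≤ w} p ≤ Q`, the `w`-smooth part of the level-`Q` band sum of the truncated singular-series
spectrum `μ²(q) ∏_{p∣q}(β_p − 1)` is EXACTLY the Euler product `∏_{p ≤ w} β_p = Σ_{U ⊆ {p ≤ w}} ∏_{p∈U}(β_p − 1)`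
(every `w`-smooth squarefree modulus is `≤ Q`; reindex by `q ↦ primeFactors q`, `U ↦ ∏ U`). -/
theorem smoothBand_hlCoeff_eq {Q w : ℕ} (hQ : primorial w ≤ Q) (a b : Fin t → ℤ) :
    smoothBand Q w (fun q b' => hlCoeff q a b') b = singularProductPartial (sys a b) w := by
  unfold smoothBand hlCoeff
  rw [EulerExpansion.singularProductPartial_eq_sum_powerset]
  refine Finset.sum_nbij' (fun q => q.primeFactors) (fun U => ∏ p ∈ U, p) ?_ ?_ ?_ ?_ (fun q _ => rfl)
  · intro q hq
    rw [Finset.mem_filter] at hq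
    rw [Finset.mem_powerset]
    intro p hp
    exact Nat.mem_primesLE.mpr ⟨hq.2 p hp, Nat.prime_of_mem_primeFactors hp⟩
  · intro U hU
    rw [Finset.mem_powerset] at hU
    have hprime : ∀ p ∈ U, p.Prime := fun p hp => Nat.prime_of_mem_primesLE (hU hp)
    rw [Finset.mem_filter, Finset.mem_filter, Finset.mem_Icc]
    refine ⟨⟨⟨Nat.one_le_iff_ne_zero.mpr (Finset.prod_ne_zero_iff.mpr fun p hp => (hprime p hp).ne_zero), ?_⟩,
      ?_⟩, ?_⟩
    · calc ∏ p ∈ U, p ≤ primorial w :=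
            Nat.le_of_dvd (primorial_pos w) (by
              rw [primorial_eq_prod_primesLE]
              exact Finset.prod_dvd_prod_of_subset U (Nat.primesLE w) (fun p => p) hU)
        _ ≤ Q := hQ
    · refine Finset.squarefree_prod_of_pairwise_isCoprime (fun p hp p' hp' hpp' => ?_)
        fun p hp => (hprime p hp).squarefree
      exact Nat.coprime_iff_isRelPrime.1 ((Nat.coprime_primes (hprime p hp) (hprime p' hp')).2 hpp')
    · intro p hp
      rw [Nat.primeFactors_prod hprime] at hp
      exact Nat.le_of_mem_primesLE (hU hp)
  · intro q hq
    rw [Finset.mem_filter, Finset.mem_filter] at hq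
    exact Nat.prod_primeFactors_of_squarefree hq.1.2
  · intro U hU
    rw [Finset.mem_powerset] at hU
    exact Nat.primeFactors_prod fun p hp => Nat.prime_of_mem_primesLE (hU hp)

end SingularWeights

open SingularWeights in
/-- **(W4) THE SMOOTH PART OF THE TRUNCATED SINGULAR-SERIES SPECTRUM IS `∏_{p ≤ w} β_p`** (registered hook, third
conjunct of `SingularWeightFacts`): with `w = ⌊log₄ N⌋ / D`, `D ≥ D₀ = ⌈1/θ⌉`, the `w`-smooth squarefree moduli are all
`≤ ∏_{p≤w} p ≤ 4^w ≤ N^{1/D} ≤ N^θ`, so the `w`-smooth part of the level-`⌊N^θ⌋` band sum of `hlCoeff` equals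
`∏_{p ≤ w} β_p(a, b)` exactly for `N ≥ 1` (the size hypothesis on `a` is not needed). -/
theorem singularWeights_W4 : ∀ (t L : ℕ) (θ : ℝ), 0 < θ → ∃ D₀ : ℕ, ∀ D : ℕ, D₀ ≤ D → ∀ ε : ℝ, 0 < ε → ∃ N₀ : ℕ, ∀ N : ℕ, N₀ ≤ N → ∀ a b : Fin t → ℤ, (∀ i, a i ≠ 0 ∧ |a i| ≤ L) → |smoothBand (level θ N) (wlev D N) (fun q b' => hlCoeff q a b') b - singularProductPartial (sys a b) (wlev D N)| ≤ ε := by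
  intro t L θ hθ
  refine ⟨⌈1 / θ⌉₊, fun D hD ε hε => ⟨1, fun N hN a b _ => ?_⟩⟩
  have hD' : 1 / θ ≤ D := (Nat.le_ceil _).trans (by exact_mod_cast hD)
  rw [smoothBand_hlCoeff_eq (primorial_wlev_le_level hθ hD' hN) a b, sub_self, abs_zero]
  exact hε.le

end Summit.Parity.GeneralizedHardyLittlewood.Cruxes.RelativeDimOne.TypeSplit

end
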